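import Summits.QuantumAdvantage.QuantumAdvantage.Theorems.AvgFaceBeyondPrior.Negative.AvgFaceBeyondPriorNecessary
import Summits.QuantumAdvantage.QuantumAdvantage.Theorems.AvgFaceBeyondPrior.Negative.AvgFaceBeyondPriorBlocks

/-!
# `AvgFaceBeyondPrior` (stmt-QuantumAdvantage-2427), negative side (3/3): the conditioning on
fundamental discriminants is load-bearing

Replace the crux's ensemble `Uₙ` (uniform on the n-bit `d` with `−d` FUNDAMENTAL) by the plain
uniform distribution on n-bit integers. Then the constant predictor `3 ∤ h` errs only on
`IQ3 ⊆ {−d fundamental}`, a set of density `≤ 1/3` in every block from `n = 5` on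
(`three_mul_card_fundBlock_le`, `AvgFaceBeyondPriorBlocks.lean`) and empty below
(`not_mem_iq3Set_of_lt_sixteen`): the `δ = 1/3` face is FALSE unconditioned
(`avgFaceBeyondPrior_false_without_conditioning`). So the crux's calibration "beat the
Cohen–Lenstra prior `0.44` by `0.11`" lives on the conditioned ensemble (unconditioned prior
`(3/π²)·0.44 ≈ 0.134`), and the `Heur_{1/3}` face does not transfer along a domination
`U ≤ 3.3·Uniform` (domination multiplies `δ`). Also the exact tiny level `n = 7`
(`level_seven_counts`: 20 fundamental, 5 with `3 ∣ h`). (cdisprove seat, 2026-08-16.)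
-/

namespace Summit.QuantumAdvantage.QuantumAdvantage.Theorems.AvgFaceBeyondPrior.Negative

open _root_.Computability
open Literature.Computability.Complexity Literature.Computability.MetaComplexity
open Literature.NumberTheory.QuadraticFields
open Summit.QuantumAdvantage.QuantumAdvantage.Theses.ArithStatLadder
open Summit.QuantumAdvantage.QuantumAdvantage.Theorems.AvgFaceBeyondPrior.Negative.Blocks
open Finset
open scoped Classical ENNReal

/-- Tiny levels, exactly (kernel `decide` on the counting definition of `h`): at `n = 7` the block
has 20 fundamental discriminants of which 5 have `3 ∣ h(−d)` (`d = 83, 87, 104, 107, 116`), so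
the constant predictor `3 ∤ h` has bad mass `1/4 ≤ 1/3` there — the crux is not decided at tiny
levels; PARI (§4 table) locates the first level with proportion `> 1/3`. [folklore] -/
theorem level_seven_counts :
    #((Ico (2 ^ 6) (2 ^ 7)).filter fun d => isFundNegNat (2 ^ 4) d = true) = 20 ∧
    #((Ico (2 ^ 6) (2 ^ 7)).filter fun d : ℕ => isFundNegNat (2 ^ 4) d = true ∧
        3 ∣ BinaryQuadraticForm.classNumber (-(d:ℤ))) = 5 := by
  constructor
  · decide +kernel
  · decide +kernel

/-- No `d < 16` lies in `IQ3` (`h(−3) = h(−4) = h(−7) = h(−8) = h(−11) = 1`, `h(−15) = 2`). [folklore] -/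
theorem not_mem_iq3Set_of_lt_sixteen {d : ℕ} (hd : d < 16) : d ∉ iq3Set := by
  rcases Nat.eq_zero_or_pos d with rfl | hpos
  · exact zero_not_mem_iq3Set
  rintro ⟨hf, h3⟩
  rw [show ((((-(d:ℤ)) % 4 = 1 ∧ Squarefree (-(d:ℤ)) ∧ (-(d:ℤ)) ≠ 1) ∨ (4 ∣ (-(d:ℤ)) ∧ ((-(d:ℤ)) / 4 % 4 = 2 ∨ (-(d:ℤ)) / 4 % 4 = 3) ∧ Squarefree ((-(d:ℤ)) / 4)))) ↔ isFundNegNat 4 d = true from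
    isFundNeg_iff_nat hpos (by omega)] at hf
  interval_cases d <;> revert hf h3 <;> decide

/-! ## The unconditioned ensemble

Replace `Uₙ` (uniform on n-bit FUNDAMENTAL `−d`) by the plain uniform distribution on n-bit
integers. Then the constant predictor `3 ∤ h` errs only on `IQ3 ⊆ {−d fundamental}`, a set of
density `≤ 1/3` in every block from `n = 5` on (§4) and empty below: the `δ = 1/3` face is FALSE
unconditioned. So the crux's calibration "beat the Cohen–Lenstra prior 0.44 by 0.11" lives
entirely on the conditioned ensemble (prior unconditioned: `(3/π²)·0.44 ≈ 0.134`); and a transfer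
of the `Heur_{1/3}` face along a domination `U ≤ 3.3·Uniform` is void (domination multiplies δ). -/

section Conditioning

open Finset

/-- The unconditioned ensemble: uniform on the n-bit integers `[2^(n-1), 2^n)` (`pure []` at
`n = 0`, where the block is empty). [folklore] -/
noncomputable def ensUnif : Ensemble := fun n =>
  if h : (Ico (2 ^ (n - 1)) (2 ^ n)).Nonempty then
    (PMF.uniformOfFinset (Ico (2 ^ (n - 1)) (2 ^ n)) h).map encodeNat
  else PMF.pure []

/-- Probabilities under the unconditioned ensemble (nonempty block). [folklore] -/
theorem ensUnif_prob_eq {n : ℕ} (h : (Ico (2 ^ (n - 1)) (2 ^ n)).Nonempty) (E : Set (List Bool)) :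
    ensUnif.prob n E =
      (((Ico (2 ^ (n - 1)) (2 ^ n)).filter fun d => encodeNat d ∈ E).card : ℝ) /
        (Ico (2 ^ (n - 1)) (2 ^ n)).card := by
  unfold Ensemble.prob ensUnif
  rw [dif_pos h, PMF.toOuterMeasure_map_apply, PMF.toOuterMeasure_uniformOfFinset_apply,
    ENNReal.toReal_div]
  simp only [Set.mem_preimage, ENNReal.toReal_natCast]

/-- The `IQ3`-part of a block of integers sits inside the block of fundamental discriminants. [folklore] -/
theorem filter_iq3_subset_fundBlock (n : ℕ) :
    ((Ico (2 ^ (n - 1)) (2 ^ n)).filter fun d => encodeNat d ∈ iq3Lang) ⊆ fundBlock n := by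
  intro d hd
  rw [mem_filter, encodeNat_mem_iq3Lang] at hd
  exact mem_filter.2 ⟨hd.1, hd.2.1⟩

/-- **Conditioning is load-bearing**: on uniform n-bit integers the `δ = 1/3` face fails — the
constant predictor `3 ∤ h` has bad mass `#(IQ3 ∩ block)/2^(n-1) ≤ #fundBlock n / 2^(n-1) ≤ 1/3`
for `n ≥ 5` (`three_mul_card_fundBlock_le`) and `0` for `n ≤ 4` (`not_mem_iq3Set_of_lt_sixteen`).
[folklore] -/
theorem avgFaceBeyondPrior_false_without_conditioning :
    (⟨iq3Lang, ensUnif⟩ : DistProblem) ∈ HeurDeltaBPP (fun _ => (1:ℝ) / 3) := by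
  refine ⟨constFalse, isPolyTime_constFalse, fun n => ?_⟩
  change ensUnif.prob n {x | (1:ℝ) / 4 ≤ constFalse.pr paramEnc (x, n)
    {b | b ≠ iq3Lang.boolIndicator x}} ≤ 1 / 3
  rw [badSet_constFalse]
  by_cases hne : (Ico (2 ^ (n - 1)) (2 ^ n)).Nonempty
  · rw [ensUnif_prob_eq hne]
    have hn1 : 1 ≤ n := by
      by_contra h0
      push Not at h0
      interval_cases n
      simp at hne
    have hcard : #(Ico (2 ^ (n - 1)) (2 ^ n)) = 2 ^ (n - 1) := by
      rw [Nat.card_Ico, show n = (n - 1) + 1 from by omega, pow_succ]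
      simp; omega
    rw [hcard]
    have hpos : (0:ℝ) < ((2 ^ (n - 1) : ℕ) : ℝ) := by positivity
    rw [div_le_div_iff₀ hpos (by norm_num : (0:ℝ) < 3), one_mul]
    have key : #((Ico (2 ^ (n - 1)) (2 ^ n)).filter fun d => encodeNat d ∈ iq3Lang) * 3 ≤
        2 ^ (n - 1) := by
      by_cases h5 : 5 ≤ n
      · have h1 := card_le_card (filter_iq3_subset_fundBlock n)
        have h2 : 3 * #(fundBlock n) ≤ 2 ^ (n - 1) := three_mul_card_fundBlock_le h5
        omega
      · have hempty : ((Ico (2 ^ (n - 1)) (2 ^ n)).filter fun d => encodeNat d ∈ iq3Lang) = ∅ := by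
          refine filter_eq_empty_iff.2 fun d hd hmem => ?_
          rw [mem_Ico] at hd
          have h16 : 2 ^ n ≤ 16 := by interval_cases n <;> norm_num
          exact not_mem_iq3Set_of_lt_sixteen (by omega) ((encodeNat_mem_iq3Lang d).1 hmem)
        rw [hempty, card_empty]
        exact Nat.zero_le _
    exact_mod_cast key
  · have h0 : ensUnif.prob n iq3Lang = 0 := by
      unfold Ensemble.prob ensUnif
      rw [dif_neg hne, PMF.toOuterMeasure_pure_apply, if_neg nil_not_mem_iq3Lang]
      simp
    rw [h0]; norm_num

end Conditioning

end Summit.QuantumAdvantage.QuantumAdvantage.Theorems.AvgFaceBeyondPrior.Negative
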